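import Literature.AlgebraicGeometry.HodgeTheory.GenericallyFramedChernClasses
import HarnessLib

/-!
# `S(ℂ)` is Hausdorff, second countable, locally compact and paracompact for an open subscheme `S` of a
# smooth projective complex variety

J.-P. Serre, *Géométrie algébrique et géométrie analytique* (1956), §2 n°5 (the analytic space of an
algebraic variety is Hausdorff and locally compact, countable at infinity); SGA1 XII Thm. 1.1 a) (an open
immersion analytifies to an open embedding — the tree's theorem `AlgPoints.isOpenEmbedding_map_holds`).
For `S ⟶ X` an open immersion into a smooth projective `X` over `ℂ` (`X(ℂ)` compact Hausdorff second
countable, tree: `ComplexPoints.compactSpace/t2Space_of_isSmoothProjective`,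
`secondCountableTopology_complexPoints_of_isSmoothProjective`), the complex points `S(ℂ)` (the tree's
`Motives.ComplexPoints S` with its analytic topology) form a Hausdorff, second countable, locally compact,
σ-compact, hence PARACOMPACT space — Husemoller's standing hypothesis (Ch. 17 (2.4)) for the topological
Chern classes (`ChernClassTheory`, `chernClassR`), so far available in the tree only for `X(ℂ)` itself
and for the subspaces `(X ∖ Z)(ℂ) ⊆ X(ℂ)` (`paracompactSpace_complexPointsCompl_of_isSmoothProjective`),
not for the complex points of the open subscheme as a scheme in its own right (the base over which the
laws of `HodgeTheory.ChernCharacterBetti` are evaluated). Everything is proved; no definitions, no named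
facts.

## References

* [SerreGAGA1956] J.-P. Serre, GAGA, Ann. Inst. Fourier 6 (1956), §2 n°5.
* [SGA1] A. Grothendieck, M. Raynaud, SGA 1, Exp. XII Thm. 1.1 a), Prop. 3.1 (xi).
* [HusemollerFibreBundles1994] D. Husemoller, *Fibre Bundles* (1994), Ch. 17 (2.4).
-/

noncomputable section

open Topology
open Literature.AlgebraicGeometry.Motives AlgebraicGeometry

namespace Literature.AlgebraicGeometry.HodgeTheory

variable {n : ℕ} {S X : SchemeOver ℂ}

/-- **`S(ℂ) ↪ X(ℂ)` is an open embedding** for an open immersion `S ⟶ X` (SGA1 XII Thm. 1.1 a); the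
tree's `AlgPoints.isOpenEmbedding_map_holds`, recorded for `ComplexPoints`). [cite: SGA1, Exp. XII Thm. 1.1, proof a)] -/
theorem isOpenEmbedding_complexPoints_map (ι : S ⟶ X) [IsOpenImmersion ι.left] :
    IsOpenEmbedding (AlgPoints.map ι : ComplexPoints S → ComplexPoints X) :=
  AlgPoints.isOpenEmbedding_map_holds ι

/-- `S(ℂ)` is Hausdorff for an open subscheme `S` of a smooth projective `X`. [cite: SerreGAGA1956, §2 n°5] -/
theorem t2Space_complexPoints_of_openImmersion (hX : IsSmoothProjective n X) (ι : S ⟶ X)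
    [IsOpenImmersion ι.left] : T2Space (ComplexPoints S) := by
  haveI := ComplexPoints.t2Space_of_isSmoothProjective hX
  exact (isOpenEmbedding_complexPoints_map ι).isEmbedding.t2Space

/-- `S(ℂ)` is second countable for an open subscheme `S` of a smooth projective `X`. [cite: SerreGAGA1956, §2 n°5] -/
theorem secondCountableTopology_complexPoints_of_openImmersion (hX : IsSmoothProjective n X) (ι : S ⟶ X)
    [IsOpenImmersion ι.left] : SecondCountableTopology (ComplexPoints S) := by
  haveI := secondCountableTopology_complexPoints_of_isSmoothProjective hX
  exact (isOpenEmbedding_complexPoints_map ι).isEmbedding.secondCountableTopology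

/-- `S(ℂ)` is locally compact for an open subscheme `S` of a smooth projective `X` (an open subspace of
the compact Hausdorff `X(ℂ)`). [cite: SerreGAGA1956, §2 n°5] -/
theorem locallyCompactSpace_complexPoints_of_openImmersion (hX : IsSmoothProjective n X) (ι : S ⟶ X)
    [IsOpenImmersion ι.left] : LocallyCompactSpace (ComplexPoints S) := by
  haveI := ComplexPoints.compactSpace_of_isSmoothProjective hX
  haveI := ComplexPoints.t2Space_of_isSmoothProjective hX
  exact (isOpenEmbedding_complexPoints_map ι).locallyCompactSpace

/-- **`S(ℂ)` is paracompact** for an open subscheme `S` of a smooth projective complex variety `X`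
(locally compact, Hausdorff, second countable, hence σ-compact and paracompact): Husemoller's
hypothesis (2.4) for the Chern classes of bundles on `S(ℂ)`. [cite: HusemollerFibreBundles1994, Ch. 17 (2.4)]
[cite: SerreGAGA1956, §2 n°5] -/
theorem paracompactSpace_complexPoints_of_openImmersion (hX : IsSmoothProjective n X) (ι : S ⟶ X)
    [IsOpenImmersion ι.left] : ParacompactSpace (ComplexPoints S) := by
  haveI := t2Space_complexPoints_of_openImmersion hX ι
  haveI := locallyCompactSpace_complexPoints_of_openImmersion hX ι
  haveI := secondCountableTopology_complexPoints_of_openImmersion hX ι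
  haveI : SigmaCompactSpace (ComplexPoints S) := sigmaCompactSpace_of_locallyCompact_secondCountable
  infer_instance

end Literature.AlgebraicGeometry.HodgeTheory

end
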